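import Literature.NumberTheory.EllipticCurves.ZpExtensionEisensteinDVRSettingH4ReadingsProofs
import Literature.NumberTheory.GaloisCohomology.Howard2004.DualityDatumLocalCupScalarReadingFlipProofs
import HarnessLib

/-!
# H.4 at the places `v ∣ p` for the curve's Eisenstein setting, VI♭: the level READINGS of the induced local pairings, onto on
# BOTH sides (the `hsurj` input of the `Y`-side AND of the `X`-side of (EXACT-REP), one reading `λ`)

`Proofs` file (theorems only; no definition, no named fact, no instance, no `sorry`).  Sequel of
`ZpExtensionEisensteinDVRSettingH4ReadingsProofs` (x9-p1-w2: `eisensteinTower_localCup_levelReadings` / `…_towerReadings` give, at each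
level `k` of the `D`-indexed towers `X_k = H¹(K_v, T^{(k)})`, `Y_k = H¹(K_v, Tw T^{(k)})`, `Q_k = H²(K_v, A_{m,k+1}(1))`,
`B_k = (D k).localCup (inr v)`, a reading `λ_k : Q_k → ℤ/p^{k+1}` with (hsurj) «the adjoint `y ↦ λ_k (· ∪_k y)` is onto
`Hom(X_k, ℤ/p^{k+1})`» and (hfrob)).  The `X`-side of (EXACT-REP) (towers exchanged, pairings `B_k.flip`) needs (hsurj) on the
OTHER side — «the adjoint `x ↦ λ_k (x ∪_k ·)` is onto `Hom(Y_k, ℤ/p^{k+1})`» — for THE SAME `λ_k` that has (hfrob).  This file proves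
the three properties together for `λ_k := inv_v ∘ H²(exp ∘ λ_{k+1})` (same construction as the companion file, plus
`DualityDatum.exists_forall_reading_localCup_eq_flip`):

* `eisensteinTower_localCup_levelReadings_both`: `∃ λ_k`, (hsurj, `Y`-witness) ∧ (hsurj, `X`-witness) ∧ (hfrob) at one level;
* `eisensteinTower_localCup_towerReadings_both`: the family `λ = (λ_k)_k` (by choice).

Cell `pub/bsd-print-x9` (shared μ-crux `MuInequalityCoherentPairOfPrintCG`, STUB A `stub_exactAtP`, (EXACT-REP-INST) `X`-side).
No summit statement is proved here; BSD is not proved by any of this.  References: [Howard2004HeegnerKolyvagin] §1.3 H.4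
(arXiv:1202.6340 p. 7 L69–82), Def. 1.1.1, Def. 3.1.2; [MilneADT2006] I §0 Prop. 0.19, Cor. 2.3; [Hungerford1974] IV §4 Ex. 1.
-/

set_option autoImplicit false

noncomputable section

open Function NumberField IsDedekindDomain Field CategoryTheory
open scoped NumberField ContRepresentation

namespace WeierstrassCurve

open Literature.NumberTheory.EllipticCurves Literature.NumberTheory.GaloisRepresentations
open Literature.NumberTheory.GaloisRepresentations.DiscreteGaloisModule
open Literature.NumberTheory.GaloisCohomology Literature.NumberTheory.GaloisCohomology.Howard2004
open Literature.NumberTheory.EllipticCurves.ZpExtension (EisensteinLevel)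

variable {K : Type} [Field K] [NumberField K] (W : WeierstrassCurve ℚ) [W.IsElliptic] {p : ℕ} [hp : Fact p.Prime]
  (κ : ZpExtension K p) {m : ℕ} (hm : 1 ≤ m) (cd : ConjugationDatum K)
  (D : letI := IwasawaAlgebra.isLocalRing_quotient_X_pow_add_C p hm
    ∀ k, DualityDatum p cd ((W.eisensteinTower κ hm).ρ k) (IwasawaAlgebra.EisensteinCoeff p m (k + 1)))

/-! ## §1 One level: `λ_k := inv_v ∘ H²(exp ∘ λ_{k+1})`, onto adjoint on both sides and Frobenius -/

/-- **The level reading (hsurj on both sides ∧ hfrob) at a finite place `v` and level `k`**: there is an additive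
`λ_k : H²(K_v, A_{m,k+1}(1)) → ℤ/p^{k+1}` such that (hsurj, `Y`-witness) every character of `H¹(K_v, T^{(k)})` is `x ↦ λ_k (x ∪_k y)` for
some `y ∈ H¹(K_v, Tw T^{(k)})`, (hsurj, `X`-witness) every character of `H¹(K_v, Tw T^{(k)})` is `y ↦ λ_k (x ∪_k y)` for some
`x ∈ H¹(K_v, T^{(k)})`, and (hfrob) `q = q′` as soon as `λ_k (H²(r •) q) = λ_k (H²(r •) q′)` for all `r ∈ A_{m,k+1}` — for ANY H.4 data
`D k`, given the Poitou–Tate named fact. [cite: Howard2004HeegnerKolyvagin, §1.3 H.4 (arXiv p. 7, L78–82) and Def. 1.1.1]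
[cite: MilneADT2006, Ch. I §0 Prop. 0.19 and Cor. 2.3] [cite: Hungerford1974, Ch. IV §4 Exercise 1] -/
theorem eisensteinTower_localCup_levelReadings_both (hPT : poitouTate_selmerStructure_duality K)
    (v : HeightOneSpectrum (𝓞 K)) (k : ℕ) :
    letI := IwasawaAlgebra.isLocalRing_quotient_X_pow_add_C p hm
    ∃ lamQ : galoisCohomology ((D k).twistOne.toLocal (Sum.inr v)) 2 →+ ZMod (p ^ (k + 1)),
      (∀ χ : galoisCohomology (((W.eisensteinTower κ hm).ρ k).toLocal (Sum.inr v)) 1 →+ ZMod (p ^ (k + 1)),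
          ∃ y : galoisCohomology ((cd.twist ((W.eisensteinTower κ hm).ρ k)).toLocal (Sum.inr v)) 1,
            ∀ x : galoisCohomology (((W.eisensteinTower κ hm).ρ k).toLocal (Sum.inr v)) 1,
              lamQ ((D k).localCup (Sum.inr v) x y) = χ x) ∧
      (∀ χ : galoisCohomology ((cd.twist ((W.eisensteinTower κ hm).ρ k)).toLocal (Sum.inr v)) 1 →+ ZMod (p ^ (k + 1)),
          ∃ x : galoisCohomology (((W.eisensteinTower κ hm).ρ k).toLocal (Sum.inr v)) 1,
            ∀ y : galoisCohomology ((cd.twist ((W.eisensteinTower κ hm).ρ k)).toLocal (Sum.inr v)) 1,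
              lamQ ((D k).localCup (Sum.inr v) x y) = χ y) ∧
      ∀ q q' : galoisCohomology ((D k).twistOne.toLocal (Sum.inr v)) 2,
        (∀ r : IwasawaAlgebra.EisensteinCoeff p m (k + 1),
          lamQ (galoisCohomology.scalarMap ((D k).twistOne.toLocal (Sum.inr v))
              (DualityDatum.isScalarLinear_toLocal (D k).isScalarLinear_twistOne (Sum.inr v)) 2 r q) =
            lamQ (galoisCohomology.scalarMap ((D k).twistOne.toLocal (Sum.inr v))
              (DualityDatum.isScalarLinear_toLocal (D k).isScalarLinear_twistOne (Sum.inr v)) 2 r q')) →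
        q = q' := by
  letI := IwasawaAlgebra.isLocalRing_quotient_X_pow_add_C p hm
  have hpp := hp.out
  haveI : NeZero (p ^ (k + 1)) := ⟨pow_ne_zero _ hpp.ne_zero⟩
  have hpK : (p : K) ≠ 0 := by exact_mod_cast hpp.ne_zero
  haveI : Finite (geomTorsion (W.baseChange K) ((p : ℤ) ^ (k + 1))) :=
    finite_torsionPoints_holds (W.baseChange K) (AlgebraicClosure K) (n := (p : ℤ) ^ (k + 1))
      (pow_ne_zero _ (by exact_mod_cast hpp.ne_zero))
  haveI : Finite (EisensteinLevel p m (fun j ↦ geomTorsion (W.baseChange K) ((p : ℤ) ^ j)) (k + 1)) :=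
    IwasawaAlgebra.EisensteinCoeff.finite_twisted (p := p) (k := k + 1)
      (M := geomTorsion (W.baseChange K) ((p : ℤ) ^ (k + 1))) hm
  have hM := W.eisensteinLevel_succ_pow_nsmul_eq_zero (K := K) (p := p) hm k
  -- the bridge data `λ = λ_{k+1}` (tail form) and `exp = log⁻¹`
  have hlam : ∀ (z : ℤ_[p]) (r : IwasawaAlgebra.EisensteinCoeff p m (k + 1)),
      (IwasawaAlgebra.EisensteinCoeff.tailFormZMod p hm (k + 1)).toAddMonoidHom
          (algebraMap ℤ_[p] (IwasawaAlgebra.EisensteinCoeff p m (k + 1)) z * r) =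
        PadicInt.toZModPow (k + 1) z *
          (IwasawaAlgebra.EisensteinCoeff.tailFormZMod p hm (k + 1)).toAddMonoidHom r := fun z r ↦ by
    rw [LinearMap.toAddMonoidHom_coe, IwasawaAlgebra.EisensteinCoeff.algebraMap_padicInt_eq_ofZMod_toZModPow p hm (k + 1),
      IwasawaAlgebra.EisensteinCoeff.tailFormZMod_ofZMod_mul]
  obtain ⟨log, hlogbij, hlogχ, -⟩ := exists_compatible_muLog K p hpK
  let Lg : MuCarrier K (p ^ (k + 1)) ≃+ ZMod (p ^ (k + 1)) := AddEquiv.ofBijective (log (k + 1)) (hlogbij (k + 1))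
  have hexpb : Function.Bijective (Lg.symm : ZMod (p ^ (k + 1)) →+ MuCarrier K (p ^ (k + 1))) := Lg.symm.bijective
  have hexp : ∀ (g : absoluteGaloisGroup K) (x : ZMod (p ^ (k + 1))),
      (Lg.symm : ZMod (p ^ (k + 1)) →+ MuCarrier K (p ^ (k + 1))) (cyclotomicCharacterModPow K p (k + 1) g * x) =
        mu K (p ^ (k + 1)) g ((Lg.symm : ZMod (p ^ (k + 1)) →+ MuCarrier K (p ^ (k + 1))) x) := fun g x ↦ by
    apply Lg.injective
    change Lg (Lg.symm _) = log (k + 1) (mu K _ g (Lg.symm x))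
    rw [AddEquiv.apply_symm_apply, hlogχ, show log (k + 1) (Lg.symm x) = Lg (Lg.symm x) from rfl,
      AddEquiv.apply_symm_apply]
  -- `Θ : Tw(T^{(k)}) → Hom(T^{(k)}, μ)` is bijective, and the dual family dualizes `A_{m,k+1}(1)`
  have hΘ := (D k).toTateDual_bijective _ hlam _ hexp hexpb
    (IwasawaAlgebra.EisensteinCoeff.tailFormZModComp_bijective p hm (k + 1))
  have hbij := IwasawaAlgebra.EisensteinCoeff.bijective_comp_tailFormZMod_dualFamily_mul p hm (k + 1) _ hexpb
  -- the Poitou–Tate family of local invariants at `n = p^{k+1}`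
  obtain ⟨inv, hperf, -, -, -⟩ := hPT (p ^ (k + 1))
  -- the reading `λ_k := inv_v ∘ H²(exp ∘ λ_{k+1})`
  let lamQ : galoisCohomology ((D k).twistOne.toLocal (Sum.inr v)) 2 →+ ZMod (p ^ (k + 1)) :=
    AddMonoidHom.mk' (fun q ↦ inv (Sum.inr v)
      (cohomologyMap ((D k).expLamLocalHom _ hlam _ hexp (Sum.inr v)) 2 q)) fun a b ↦
        (congrArg (inv (Sum.inr v)) (map_add _ a b)).trans (map_add _ _ _)
  refine ⟨lamQ, fun χ ↦ ?_, fun χ ↦ ?_, fun q q' h ↦ ?_⟩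
  · exact (D k).exists_forall_reading_localCup_eq _ hlam _ hexp hM hΘ v (inv (Sum.inr v))
      ((hperf v).2 _ hM).1.1 ((hperf v).2 _ hM).2.1 χ
  · exact (D k).exists_forall_reading_localCup_eq_flip _ hlam _ hexp hM hΘ v (inv (Sum.inr v))
      ((hperf v).2 _ hM).1.1 ((hperf v).2 _ hM).2.1 χ
  · exact (D k).eq_of_forall_reading_scalarMap_two_eq _ hlam _ hexp (Sum.inr v) (inv (Sum.inr v)) (hperf v).1.1
      (IwasawaAlgebra.EisensteinCoeff.dualFamily p hm (k + 1)) hbij q q'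
      fun i ↦ h (IwasawaAlgebra.EisensteinCoeff.dualFamily p hm (k + 1) i)

/-! ## §2 The family of readings, in the binder shapes of the representability theorem on both sides -/

/-- **The level readings of the H.4 descent for the curve's Eisenstein setting at a finite place `v`, as a family, onto on both
sides**: there are additive `λ_k : H²(K_v, A_{m,k+1}(1)) → ℤ/p^{k+1}` (`k : ℕ`) such that for every `k`: (hsurj, `Y`-witness) the adjoint
`y ↦ λ_k (· ∪_k y)` is onto `Hom(H¹(K_v, T^{(k)}), ℤ/p^{k+1})`, (hsurj, `X`-witness) the adjoint `x ↦ λ_k (x ∪_k ·)` is onto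
`Hom(H¹(K_v, Tw T^{(k)}), ℤ/p^{k+1})`, and (hfrob) the readings `λ_k (H²(r •) q)`, `r ∈ A_{m,k+1}`, determine `q` — the hypotheses
`hsurj`, `hfrob` of `Tower.exists_sub_pow_smul_forall_pairing_eq_zero` for the pairings `B_k` AND for `B_k.flip`, one reading `λ`.
[cite: Howard2004HeegnerKolyvagin, §1.3 H.4 (arXiv p. 7, L78–82), Def. 1.1.1 and Def. 3.1.2] [cite: MilneADT2006, Ch. I §0 Prop. 0.19 and Cor. 2.3] -/
theorem eisensteinTower_localCup_towerReadings_both (hPT : poitouTate_selmerStructure_duality K)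
    (v : HeightOneSpectrum (𝓞 K)) :
    letI := IwasawaAlgebra.isLocalRing_quotient_X_pow_add_C p hm
    ∃ lamQ : ∀ k : ℕ, galoisCohomology ((D k).twistOne.toLocal (Sum.inr v)) 2 →+ ZMod (p ^ (k + 1)),
      ∀ k : ℕ,
        (∀ χ : galoisCohomology (((W.eisensteinTower κ hm).ρ k).toLocal (Sum.inr v)) 1 →+ ZMod (p ^ (k + 1)),
            ∃ y : galoisCohomology ((cd.twist ((W.eisensteinTower κ hm).ρ k)).toLocal (Sum.inr v)) 1,
              ∀ x : galoisCohomology (((W.eisensteinTower κ hm).ρ k).toLocal (Sum.inr v)) 1,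
                lamQ k ((D k).localCup (Sum.inr v) x y) = χ x) ∧
        (∀ χ : galoisCohomology ((cd.twist ((W.eisensteinTower κ hm).ρ k)).toLocal (Sum.inr v)) 1 →+ ZMod (p ^ (k + 1)),
            ∃ x : galoisCohomology (((W.eisensteinTower κ hm).ρ k).toLocal (Sum.inr v)) 1,
              ∀ y : galoisCohomology ((cd.twist ((W.eisensteinTower κ hm).ρ k)).toLocal (Sum.inr v)) 1,
                lamQ k ((D k).localCup (Sum.inr v) x y) = χ y) ∧
        ∀ q q' : galoisCohomology ((D k).twistOne.toLocal (Sum.inr v)) 2,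
          (∀ r : IwasawaAlgebra.EisensteinCoeff p m (k + 1),
            lamQ k (galoisCohomology.scalarMap ((D k).twistOne.toLocal (Sum.inr v))
                (DualityDatum.isScalarLinear_toLocal (D k).isScalarLinear_twistOne (Sum.inr v)) 2 r q) =
              lamQ k (galoisCohomology.scalarMap ((D k).twistOne.toLocal (Sum.inr v))
                (DualityDatum.isScalarLinear_toLocal (D k).isScalarLinear_twistOne (Sum.inr v)) 2 r q')) →
          q = q' := by
  letI := IwasawaAlgebra.isLocalRing_quotient_X_pow_add_C p hm
  choose lamQ hlamQ using fun k ↦ W.eisensteinTower_localCup_levelReadings_both κ hm cd D hPT v k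
  exact ⟨lamQ, hlamQ⟩

end WeierstrassCurve

end
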